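import Literature.MathematicalPhysics.QuantumFieldTheory.Balaban1983to89.Setup
import HarnessLib

/-!
# DAG node N07 [B11] — road R0′ row (r3) «V-SLOT SHIFT», reading (a) SIZE ONLY (lane owner dag-n07-e g20): Prop. 4's (98)-slot of the V-current read at the
# SHIFTED argument `A₁ + HB″ + ∂μ + HN₂` of the R0′ heart — the (115)∕(98) letters of a sum of bond fields add, so the slot holds at radius
# `r₁ + r₂ + r₃ + r₄ < a₃`; k0-s1-w2's `hWq` hypothesis shape (one-level and weighted∕`levOf` editions) unchanged, pure normed-group bookkeeping

Cell `pub-ymgap` (HUMAN RULINGS D-0062 ∕ D-0149 ∕ D-0154), width seat `pub-ymgap-dag-n07-w5` g0, 2026-08-28.  `--kind proof --supports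
stmt-QuantumFields-20542 --as helper` (K1⁷; count-neutral helper on the N07 [B11] row; road R0′ of record (plan g83 WORDS-2), row (r3) = this seat (dag-n07-e
g19 WORD-ROAD, g20 ANSWER (B) «reading (a) — SIZE ONLY … ONE monotonicity row over k0-s1-w2's `…K0Stub1V0SlotAtRecord(Levels).exists_W_V0_flat` at radius
`r‴ := r″ + 2B₀σ + B₀ν₂`; consumer binder = k0-s1-w2's `hWq` shape, unchanged»); sixth file of this seat).

THE PRINT.  [B11] = T. Bałaban, *The variational problem and background fields in renormalization group method for lattice gauge theories*, Commun.
Math. Phys. **102** (1985) 277–309 `[Balaban1985Variational]`, Prop. 4 p. 293: «|((δ∕δA′)V)(A′)|₍₋₃₎ ≤ C₄(max{|A′|₍₋₁₎, |∇A′|₍₋₂₎})², (98) and it is valid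
if max{|A′|₍₋₁₎, |∇A′|₍₋₂₎} ≤ a₃»; Sect. F pp. 302–303 (158)–(159): the V-slot enters the minimiser through `A₁ = −G̃((δ∕δA′)V)(A₁ + HB)`, «The configurations HB
and A₁ satisfy (152) with the bounds 4dL²B₁Mε₀ and 40dL²B₁Mε₀ correspondingly … We assume that it belongs to the domain on which this equation has a unique
solution, i.e. we assume that 40dL²B₁Mε₀ ≤ a₄»; (165) p. 304 (the quadratic channel «B₀C₄(36dL²B₁Mε₀)²»).  On road R0′ (pure-gauge shear of the datum) the
argument of the slot is `A₁ + HB″ + ∂μ + HN₂` (`∂μ = H(∂_cλ)`, dag-n07-w7 `…N07FlatHOfCoarseGradient.hOp_coarseGradient_eq_grad`; `N₂` = the BCH remainder of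
row (r1)); print never transforms the V-slot, it SIZES it — so the only (r3) row the heart needs is the slot at the enlarged radius.

WHAT THIS FILE DOES (kernel bookkeeping in a seminormed group; the V-slot `W` and its (98)-bound are HYPOTHESES in k0-s1-w2's literal `hWq` shapes —
`Thm/BalabanUVNodesK0Stub1V0SlotAtRecord.exists_W_V0_flat` (one level, unweighted, `a₃ = 1∕16`) and `Thm/…V0SlotAtRecordLevels.exists_W_V0_flat_levOf` (weights
`w m b`); nothing of `curV0` ∕ `Space115` is imported, nothing of Prop. 4 is asserted).  Generic torus `P : Params`, bond fields `PBond P 0 → 𝔸`.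
* §1 `letters98_sup_add`, `letters98_diff_add` (one summand at a time: the sup-letter `w₁ b·‖Y b‖` and the difference-letter `w₂ b·Λ·‖Y⟨b₋ + e_ν, μ⟩ − Y b‖`
  of `Y + Y′` are at most the sums, for nonneg weights `w₁, w₂` and scale `Λ ≥ 0`), `letters98_add₄` (four summands).
* §2 ★★★ `slot98_at_shifted_argument_levels` — WEIGHTED shape: if `W` obeys the (98)-slot «`r < a₃` ∧ sup-letter `≤ r` ∧ difference-letter `≤ r` ⇒
  `w₃ b·‖W Y b‖ ≤ C·r²`» and the four summands carry letters `r₁, …, r₄` with `r₁ + r₂ + r₃ + r₄ < a₃`, then `w₃ b·‖W (Y₁ + Y₂ + Y₃ + Y₄) b‖ ≤ C·(r₁ + r₂ + r₃ + r₄)²`.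
* §3 ★★ `slot98_at_shifted_argument` — the UNWEIGHTED one-level shape (`∀ b, ‖Y b‖ ≤ r`, `∀ s μ ν, Lᵏ·‖Y⟨s + e_ν, μ⟩ − Y⟨s, μ⟩‖ ≤ r`, quantifiers verbatim).

HONEST FRAMING (binding).  Count-neutral helper; triangle inequality + monotonicity only; the letters `r₃ = 2B₀σ` (print's (46) at the datum `∂_cλ`) and
`r₄ = B₀ν₂` are the CONSUMER's (rows (r1)∕(r4) supply `σ, ν₂`; `B₀` is print's (46) constant) — NOT supplied here; no covariance statement (reading (b)) is made or
needed (lane ruling).  Tokens ∕ stub 1 ∕ K0⁷ ∕ K1⁷ NOT closed; N07 NOT discharged (5∕27 unmoved); one finite `T⁴` programme at fixed `ε`, Bałaban AS PRINTED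
— R4 closes rung `BalabanLadder.UV` only; no summit statement is proved by this seat; NOT continuum ∕ ℝ⁴ ∕ OS ∕ mass gap ∕ Clay.  No `sorry`, no `def`, no
`instance`, no `notation`.
-/

noncomputable section

namespace Summit.QuantumFields.YangMills.BalabanUVNodes.N07VSlotShiftedRadius

open Literature.MathematicalPhysics.QuantumFieldTheory.Balaban1983to89

variable {P : Params} {𝔸 : Type*} [SeminormedAddCommGroup 𝔸]

/-! ## §1  The (115)∕(98) letters of a sum -/

/-- The weighted SUP-letter of a sum: `w b·‖(Y + Y′) b‖ ≤ r + r′` from `w b·‖Y b‖ ≤ r`, `w b·‖Y′ b‖ ≤ r′` (`w ≥ 0`).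
[cite: Balaban1985Variational, (98) p.293 (bookkeeping)] -/
theorem letters98_sup_add {w : PBond P 0 → ℝ} (hw : ∀ b, 0 ≤ w b) {Y Y' : PBond P 0 → 𝔸} {r r' : ℝ}
    (hY : ∀ b, w b * ‖Y b‖ ≤ r) (hY' : ∀ b, w b * ‖Y' b‖ ≤ r') (b : PBond P 0) :
    w b * ‖(Y + Y') b‖ ≤ r + r' := by
  have h := norm_add_le (Y b) (Y' b)
  have h2 : w b * ‖(Y + Y') b‖ ≤ w b * (‖Y b‖ + ‖Y' b‖) := mul_le_mul_of_nonneg_left h (hw b)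
  rw [mul_add] at h2
  linarith [hY b, hY' b]

/-- The weighted DIFFERENCE-letter of a sum: `w b·Λ·‖(Y + Y′)⟨b₋ + e_ν, μ⟩ − (Y + Y′) b‖ ≤ r + r′` from the letters of the summands (`w ≥ 0`, `Λ ≥ 0`).
[cite: Balaban1985Variational, (98) p.293 (bookkeeping)] -/
theorem letters98_diff_add {w : PBond P 0 → ℝ} (hw : ∀ b, 0 ≤ w b) {Λ : ℝ} (hΛ : 0 ≤ Λ) {Y Y' : PBond P 0 → 𝔸} {r r' : ℝ}
    (hY : ∀ (b : PBond P 0) (ν : Fin P.d), w b * Λ * ‖Y ⟨b.src.shift ν, b.dir⟩ - Y b‖ ≤ r)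
    (hY' : ∀ (b : PBond P 0) (ν : Fin P.d), w b * Λ * ‖Y' ⟨b.src.shift ν, b.dir⟩ - Y' b‖ ≤ r') (b : PBond P 0) (ν : Fin P.d) :
    w b * Λ * ‖(Y + Y') ⟨b.src.shift ν, b.dir⟩ - (Y + Y') b‖ ≤ r + r' := by
  have hsplit : (Y + Y') ⟨b.src.shift ν, b.dir⟩ - (Y + Y') b = (Y ⟨b.src.shift ν, b.dir⟩ - Y b) + (Y' ⟨b.src.shift ν, b.dir⟩ - Y' b) := by
    simp only [Pi.add_apply]
    abel
  rw [hsplit]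
  have h := norm_add_le (Y ⟨b.src.shift ν, b.dir⟩ - Y b) (Y' ⟨b.src.shift ν, b.dir⟩ - Y' b)
  have hwΛ : 0 ≤ w b * Λ := mul_nonneg (hw b) hΛ
  have h2 := mul_le_mul_of_nonneg_left h hwΛ
  rw [mul_add] at h2
  linarith [hY b ν, hY' b ν]

/-- Four summands (`A₁ + HB″ + ∂μ + HN₂`): both letters of the sum are at most `r₁ + r₂ + r₃ + r₄`. [cite: Balaban1985Variational, (98) p.293 (bookkeeping)] -/
theorem letters98_add₄ {w₁ w₂ : PBond P 0 → ℝ} (hw₁ : ∀ b, 0 ≤ w₁ b) (hw₂ : ∀ b, 0 ≤ w₂ b) {Λ : ℝ} (hΛ : 0 ≤ Λ)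
    {Y₁ Y₂ Y₃ Y₄ : PBond P 0 → 𝔸} {r₁ r₂ r₃ r₄ : ℝ}
    (h₁ : (∀ b, w₁ b * ‖Y₁ b‖ ≤ r₁) ∧ ∀ (b : PBond P 0) (ν : Fin P.d), w₂ b * Λ * ‖Y₁ ⟨b.src.shift ν, b.dir⟩ - Y₁ b‖ ≤ r₁)
    (h₂ : (∀ b, w₁ b * ‖Y₂ b‖ ≤ r₂) ∧ ∀ (b : PBond P 0) (ν : Fin P.d), w₂ b * Λ * ‖Y₂ ⟨b.src.shift ν, b.dir⟩ - Y₂ b‖ ≤ r₂)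
    (h₃ : (∀ b, w₁ b * ‖Y₃ b‖ ≤ r₃) ∧ ∀ (b : PBond P 0) (ν : Fin P.d), w₂ b * Λ * ‖Y₃ ⟨b.src.shift ν, b.dir⟩ - Y₃ b‖ ≤ r₃)
    (h₄ : (∀ b, w₁ b * ‖Y₄ b‖ ≤ r₄) ∧ ∀ (b : PBond P 0) (ν : Fin P.d), w₂ b * Λ * ‖Y₄ ⟨b.src.shift ν, b.dir⟩ - Y₄ b‖ ≤ r₄) :
    (∀ b, w₁ b * ‖(Y₁ + Y₂ + Y₃ + Y₄) b‖ ≤ r₁ + r₂ + r₃ + r₄) ∧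
      ∀ (b : PBond P 0) (ν : Fin P.d), w₂ b * Λ * ‖(Y₁ + Y₂ + Y₃ + Y₄) ⟨b.src.shift ν, b.dir⟩ - (Y₁ + Y₂ + Y₃ + Y₄) b‖ ≤ r₁ + r₂ + r₃ + r₄ := by
  have s12 := letters98_sup_add hw₁ h₁.1 h₂.1
  have s123 := letters98_sup_add hw₁ s12 h₃.1
  have s1234 := letters98_sup_add hw₁ s123 h₄.1
  have d12 := letters98_diff_add hw₂ hΛ h₁.2 h₂.2
  have d123 := letters98_diff_add hw₂ hΛ d12 h₃.2
  have d1234 := letters98_diff_add hw₂ hΛ d123 h₄.2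
  exact ⟨s1234, d1234⟩

/-! ## §2  The (98)-slot at the shifted argument — weighted (`levOf`) shape -/

/-- ★★★ **PROP. 4's (98)-SLOT AT THE SHIFTED ARGUMENT `A₁ + HB″ + ∂μ + HN₂` OF THE R0′ HEART, weighted shape** (k0-s1-w2
`…V0SlotAtRecordLevels.exists_W_V0_flat_levOf`'s `hWq`, third conjunct, as the hypothesis `hWq` — threshold `a₃` and constant `C` as parameters): if the four
summands carry (115)-letters `r₁, …, r₄` (sup with weight `w₁`, difference with weight `w₂` and scale `Λ = Lᵏ`) and `r₁ + r₂ + r₃ + r₄ < a₃`, then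
`w₃ b·‖W (A₁ + HB″ + ∂μ + HN₂) b‖ ≤ C·(r₁ + r₂ + r₃ + r₄)²` on every bond — print's «valid if max{|A′|₍₋₁₎, |∇A′|₍₋₂₎} ≤ a₃» at the enlarged radius; `r₃ = 2B₀σ`,
`r₄ = B₀ν₂` are the consumer's letters (rows (r1)∕(r4)). [cite: Balaban1985Variational, Prop. 4 (98) p.293, (158)-(159) pp.302-303, (165) p.304] -/
theorem slot98_at_shifted_argument_levels {w₁ w₂ w₃ : PBond P 0 → ℝ} (hw₁ : ∀ b, 0 ≤ w₁ b) (hw₂ : ∀ b, 0 ≤ w₂ b) {Λ : ℝ} (hΛ : 0 ≤ Λ)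
    {W : (PBond P 0 → 𝔸) → (PBond P 0 → 𝔸)} {C a₃ : ℝ}
    (hWq : ∀ (Y : PBond P 0 → 𝔸) (r : ℝ), r < a₃ → (∀ b, w₁ b * ‖Y b‖ ≤ r) →
      (∀ (b : PBond P 0) (ν : Fin P.d), w₂ b * Λ * ‖Y ⟨b.src.shift ν, b.dir⟩ - Y b‖ ≤ r) → ∀ b, w₃ b * ‖W Y b‖ ≤ C * r ^ 2)
    {Y₁ Y₂ Y₃ Y₄ : PBond P 0 → 𝔸} {r₁ r₂ r₃ r₄ : ℝ}
    (h₁ : (∀ b, w₁ b * ‖Y₁ b‖ ≤ r₁) ∧ ∀ (b : PBond P 0) (ν : Fin P.d), w₂ b * Λ * ‖Y₁ ⟨b.src.shift ν, b.dir⟩ - Y₁ b‖ ≤ r₁)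
    (h₂ : (∀ b, w₁ b * ‖Y₂ b‖ ≤ r₂) ∧ ∀ (b : PBond P 0) (ν : Fin P.d), w₂ b * Λ * ‖Y₂ ⟨b.src.shift ν, b.dir⟩ - Y₂ b‖ ≤ r₂)
    (h₃ : (∀ b, w₁ b * ‖Y₃ b‖ ≤ r₃) ∧ ∀ (b : PBond P 0) (ν : Fin P.d), w₂ b * Λ * ‖Y₃ ⟨b.src.shift ν, b.dir⟩ - Y₃ b‖ ≤ r₃)
    (h₄ : (∀ b, w₁ b * ‖Y₄ b‖ ≤ r₄) ∧ ∀ (b : PBond P 0) (ν : Fin P.d), w₂ b * Λ * ‖Y₄ ⟨b.src.shift ν, b.dir⟩ - Y₄ b‖ ≤ r₄)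
    (hsum : r₁ + r₂ + r₃ + r₄ < a₃) (b : PBond P 0) :
    w₃ b * ‖W (Y₁ + Y₂ + Y₃ + Y₄) b‖ ≤ C * (r₁ + r₂ + r₃ + r₄) ^ 2 := by
  obtain ⟨hs, hd⟩ := letters98_add₄ hw₁ hw₂ hΛ h₁ h₂ h₃ h₄
  exact hWq (Y₁ + Y₂ + Y₃ + Y₄) (r₁ + r₂ + r₃ + r₄) hsum hs hd b

/-- The same with TWO summands (e.g. print's own `A₁ + HB`, or «old argument + total shift»). [cite: Balaban1985Variational, Prop. 4 (98) p.293, (158) p.302] -/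
theorem slot98_at_shifted_argument_levels₂ {w₁ w₂ w₃ : PBond P 0 → ℝ} (hw₁ : ∀ b, 0 ≤ w₁ b) (hw₂ : ∀ b, 0 ≤ w₂ b) {Λ : ℝ} (hΛ : 0 ≤ Λ)
    {W : (PBond P 0 → 𝔸) → (PBond P 0 → 𝔸)} {C a₃ : ℝ}
    (hWq : ∀ (Y : PBond P 0 → 𝔸) (r : ℝ), r < a₃ → (∀ b, w₁ b * ‖Y b‖ ≤ r) →
      (∀ (b : PBond P 0) (ν : Fin P.d), w₂ b * Λ * ‖Y ⟨b.src.shift ν, b.dir⟩ - Y b‖ ≤ r) → ∀ b, w₃ b * ‖W Y b‖ ≤ C * r ^ 2)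
    {Y Y' : PBond P 0 → 𝔸} {r r' : ℝ}
    (hY : (∀ b, w₁ b * ‖Y b‖ ≤ r) ∧ ∀ (b : PBond P 0) (ν : Fin P.d), w₂ b * Λ * ‖Y ⟨b.src.shift ν, b.dir⟩ - Y b‖ ≤ r)
    (hY' : (∀ b, w₁ b * ‖Y' b‖ ≤ r') ∧ ∀ (b : PBond P 0) (ν : Fin P.d), w₂ b * Λ * ‖Y' ⟨b.src.shift ν, b.dir⟩ - Y' b‖ ≤ r')
    (hsum : r + r' < a₃) (b : PBond P 0) :
    w₃ b * ‖W (Y + Y') b‖ ≤ C * (r + r') ^ 2 :=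
  hWq (Y + Y') (r + r') hsum (letters98_sup_add hw₁ hY.1 hY'.1) (letters98_diff_add hw₂ hΛ hY.2 hY'.2) b

/-! ## §3  The (98)-slot at the shifted argument — one-level unweighted shape -/

/-- ★★ **THE SAME IN THE ONE-LEVEL UNWEIGHTED SHAPE** of k0-s1-w2 `…V0SlotAtRecord.exists_W_V0_flat` (third conjunct, quantifiers `∀ s μ ν` verbatim,
scale `Λ = Lᵏ`): four summands with letters `rᵢ` and `r₁ + r₂ + r₃ + r₄ < a₃` give `‖W (Y₁ + Y₂ + Y₃ + Y₄) b‖ ≤ C·(r₁ + r₂ + r₃ + r₄)²`.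
[cite: Balaban1985Variational, Prop. 4 (98) p.293, (158)-(159) pp.302-303] -/
theorem slot98_at_shifted_argument {Λ : ℝ} (hΛ : 0 ≤ Λ) {W : (PBond P 0 → 𝔸) → (PBond P 0 → 𝔸)} {C a₃ : ℝ}
    (hWq : ∀ (Y : PBond P 0 → 𝔸) (r : ℝ), r < a₃ → (∀ b, ‖Y b‖ ≤ r) →
      (∀ (s : Site P 0) (μ ν : Fin P.d), Λ * ‖Y ⟨s.shift ν, μ⟩ - Y ⟨s, μ⟩‖ ≤ r) → ∀ b, ‖W Y b‖ ≤ C * r ^ 2)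
    {Y₁ Y₂ Y₃ Y₄ : PBond P 0 → 𝔸} {r₁ r₂ r₃ r₄ : ℝ}
    (h₁ : (∀ b, ‖Y₁ b‖ ≤ r₁) ∧ ∀ (s : Site P 0) (μ ν : Fin P.d), Λ * ‖Y₁ ⟨s.shift ν, μ⟩ - Y₁ ⟨s, μ⟩‖ ≤ r₁)
    (h₂ : (∀ b, ‖Y₂ b‖ ≤ r₂) ∧ ∀ (s : Site P 0) (μ ν : Fin P.d), Λ * ‖Y₂ ⟨s.shift ν, μ⟩ - Y₂ ⟨s, μ⟩‖ ≤ r₂)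
    (h₃ : (∀ b, ‖Y₃ b‖ ≤ r₃) ∧ ∀ (s : Site P 0) (μ ν : Fin P.d), Λ * ‖Y₃ ⟨s.shift ν, μ⟩ - Y₃ ⟨s, μ⟩‖ ≤ r₃)
    (h₄ : (∀ b, ‖Y₄ b‖ ≤ r₄) ∧ ∀ (s : Site P 0) (μ ν : Fin P.d), Λ * ‖Y₄ ⟨s.shift ν, μ⟩ - Y₄ ⟨s, μ⟩‖ ≤ r₄)
    (hsum : r₁ + r₂ + r₃ + r₄ < a₃) (b : PBond P 0) :
    ‖W (Y₁ + Y₂ + Y₃ + Y₄) b‖ ≤ C * (r₁ + r₂ + r₃ + r₄) ^ 2 := by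
  -- read the unweighted letters as weight-`1` letters on bonds `⟨s, μ⟩`
  have toW : ∀ {Y : PBond P 0 → 𝔸} {r : ℝ},
      ((∀ b, ‖Y b‖ ≤ r) ∧ ∀ (s : Site P 0) (μ ν : Fin P.d), Λ * ‖Y ⟨s.shift ν, μ⟩ - Y ⟨s, μ⟩‖ ≤ r) →
      (∀ b, (fun _ : PBond P 0 => (1 : ℝ)) b * ‖Y b‖ ≤ r) ∧
        ∀ (b : PBond P 0) (ν : Fin P.d), (fun _ : PBond P 0 => (1 : ℝ)) b * Λ * ‖Y ⟨b.src.shift ν, b.dir⟩ - Y b‖ ≤ r := by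
    intro Y r h
    refine ⟨fun b => by simpa using h.1 b, fun b ν => ?_⟩
    have := h.2 b.src b.dir ν
    simpa using this
  obtain ⟨hs, hd⟩ := letters98_add₄ (w₁ := fun _ => (1 : ℝ)) (w₂ := fun _ => (1 : ℝ)) (fun _ => zero_le_one) (fun _ => zero_le_one) hΛ
    (toW h₁) (toW h₂) (toW h₃) (toW h₄)
  refine hWq (Y₁ + Y₂ + Y₃ + Y₄) (r₁ + r₂ + r₃ + r₄) hsum (fun b' => by simpa using hs b') (fun s μ ν => ?_) b
  have := hd ⟨s, μ⟩ ν
  simpa using this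

end Summit.QuantumFields.YangMills.BalabanUVNodes.N07VSlotShiftedRadius

end
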